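import Mathlib
import HarnessLib
import Summits.NavierStokesRegularity.NavierStokesRegularity.Theorems.PoloidalWindowDoorPoloidalWindowRigidityLargeScaleEnergyBootstrapFloorTools

/-!
# Route `PoloidalWindowDoor`, crux `PoloidalWindowRigidity` (K2, stmt-NavierStokesRegularity-19708) — whole-class tool:
# THE FLOOR STEP OF THE LARGE-SCALE ENERGY BOOTSTRAP on a time window (level `R^α ↦ R^{(1+α)/2}`), CONDITIONAL on
# the `L²` mean-oscillation bound for the pressure

Cell ns-regularity-ideate, seat ns-poloidal-K2-p3 gen 3 (stub-worker under the K2 lead; file landed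
`--supports stmt-NavierStokesRegularity-19708` as a helper).  Twin of `…LargeScaleEnergyBootstrap.energy_ball_le_of_level`
with the pressure paired against the velocity in `L²` (Cauchy–Schwarz, `flux_le_two`) instead of `L³`:
* `energy_ball_le_of_level_two` — on the ancient window `[−R², t₂]`, `R ≥ √(−t₂)`: LEVEL `α` at radius `2R`
  (`∫_{B̄_{2R}}‖u(s)‖² ≤ K₀(2R)^α(−s)^{−(α−1)/2}`, `1 < α < 3`) + the `L²` oscillation `∃ c, ∫_{B̄_{2R}}|p(s)−c|² ≤
  (A/(−s))²|B̄_{2R}|` ⇒ `∫_{B(0,R)}‖u(t₂)‖² ≤ K'·R^{(1+α)/2}·(−t₂)^{−(α−1)/4}`,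
  `K' = K₀2^α(1 + 2C₂/(3−α)) + C₁2^{(3+α)/2}|B̄₁|^{1/2}K₀^{1/2}(C²+2A)·4/(α−1)`.
The new exponents are again scale-invariant; iterating `α ↦ (1+α)/2` from `2` reaches every `α > 1`
(`…LargeScaleEnergyBootstrapFloor`).

WHAT THIS IS NOT: not a claim about Navier–Stokes regularity — an energy estimate conditional on an explicit pressure
hypothesis (bears_on LADDER-NS N0).
-/

noncomputable section

-- the summit and its single sub-problem share the name (CONVENTIONS §1), as in every Theorems file
set_option linter.dupNamespace false

namespace Summit.NavierStokesRegularity.NavierStokesRegularity.Theorems.PoloidalWindowDoorPoloidalWindowRigidityLargeScaleEnergyBootstrapFloorStep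

open MeasureTheory Set Function Filter Topology TopologicalSpace Metric InnerProductSpace
open scoped RealInnerProductSpace InnerProductSpace Laplacian ContDiff
open Literature.Analysis Literature.Analysis.FluidPDE
open Summit.NavierStokesRegularity.NavierStokesRegularity.Theorems.PoloidalWindowDoorPoloidalWindowRigidityLargeScaleEnergyDecayTools
  (setIntegral_ball_le_integral_cutoff)
open Summit.NavierStokesRegularity.NavierStokesRegularity.Theorems.PoloidalWindowDoorPoloidalWindowRigidityLargeScaleEnergyBootstrapTools
open Summit.NavierStokesRegularity.NavierStokesRegularity.Theorems.PoloidalWindowDoorPoloidalWindowRigidityLargeScaleEnergyBootstrap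
open Summit.NavierStokesRegularity.NavierStokesRegularity.Theorems.PoloidalWindowDoorPoloidalWindowRigidityLargeScaleEnergyBootstrapFloorTools

variable {S : Set ℝ} {u : ℝ → EuclideanSpace ℝ (Fin 3) → EuclideanSpace ℝ (Fin 3)}
  {p : ℝ → EuclideanSpace ℝ (Fin 3) → ℝ}

/-! ### The floor step on a window -/

/-- **THE FLOOR STEP OF THE LARGE-SCALE ENERGY BOOTSTRAP (conditional on the `L²` pressure hypothesis).**
Let `(u,p)` be a classical solution of the unforced unit-viscosity Navier–Stokes system on an open time set
`S ⊇ [−R², t₂]`, `t₂ < 0`, `√(−t₂) ≤ R`, with `‖u(s,x)‖ ≤ C/√(−s)` on the window, the level-`α` energy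
bound `∫_{B̄(0,2R)}‖u(s)‖² ≤ K₀(2R)^α(−s)^{−(α−1)/2}` (`1 < α < 3`, `K₀ ≥ 0`) and, for some `A ≥ 0`, the mean
oscillation bound `∃ c, ∫_{B̄(0,2R)} |p(s) − c|² ≤ (A/(−s))²·|B̄(0,2R)|` at every `s ∈ [−R², t₂]`.
Then, with the cut-off constants `‖D(cutoff R)‖ ≤ C₁/R`, `|Δ(cutoff R)| ≤ C₂/R²`:
`∫_{B(0,R)} ‖u(t₂)‖² ≤ K'·R^{(1+α)/2}·(−t₂)^{−(α−1)/4}`,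
`K' = K₀2^α(1 + C₂·2/(3−α)) + C₁2^{(3+α)/2}|B̄(0,1)|^{1/2}K₀^{1/2}(C²+2A)(4/(α−1))`. -/
theorem energy_ball_le_of_level_two (h : IsClassicalNSSolutionOn S 1 0 u p) (hS : IsOpen S) {t₂ R : ℝ}
    (h2 : t₂ < 0) (hRt : Real.sqrt (-t₂) ≤ R) (hI : Icc (-R ^ 2) t₂ ⊆ S) {C A K₀ α C₁ C₂ : ℝ}
    (hA0 : 0 ≤ A) (hK0 : 0 ≤ K₀) (hα1 : 1 < α) (hα3 : α < 3)
    (hC : ∀ s ∈ Icc (-R ^ 2) t₂, ∀ x, ‖u s x‖ ≤ C / Real.sqrt (-s))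
    (hE : ∀ s ∈ Icc (-R ^ 2) t₂, ∫ x in closedBall (0 : EuclideanSpace ℝ (Fin 3)) (2 * R), ‖u s x‖ ^ 2 ≤
      K₀ * (2 * R) ^ α * (-s) ^ (-((α - 1) / 2)))
    (hosc : ∀ s ∈ Icc (-R ^ 2) t₂, ∃ c : ℝ,
      ∫ x in closedBall (0 : EuclideanSpace ℝ (Fin 3)) (2 * R), |p s x - c| ^ (2 : ℝ) ≤
        (A / (-s)) ^ (2 : ℝ) * volume.real (closedBall (0 : EuclideanSpace ℝ (Fin 3)) (2 * R)))
    (hC₁ : ∀ x, ‖fderiv ℝ (cutoff (E := EuclideanSpace ℝ (Fin 3)) R) x‖ ≤ C₁ / R)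
    (hC₂ : ∀ x, |(Δ (cutoff (E := EuclideanSpace ℝ (Fin 3)) R)) x| ≤ C₂ / R ^ 2) :
    ∫ x in ball (0 : EuclideanSpace ℝ (Fin 3)) R, ‖u t₂ x‖ ^ 2 ≤
      (K₀ * 2 ^ α * (1 + C₂ * (2 / (3 - α))) +
        C₁ * 2 ^ ((3 + α) / 2) * volume.real (closedBall (0 : EuclideanSpace ℝ (Fin 3)) 1) ^ (1 / 2 : ℝ) *
          K₀ ^ (1 / 2 : ℝ) * (C ^ 2 + 2 * A) * (4 / (α - 1))) *
        R ^ ((1 + α) / 2) * (-t₂) ^ (-((α - 1) / 4)) := by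
  -- elementary facts about the window
  have ht2 : 0 < -t₂ := neg_pos.2 h2
  have hr0 : 0 < Real.sqrt (-t₂) := Real.sqrt_pos.2 ht2
  have hR : 0 < R := lt_of_lt_of_le hr0 hRt
  have hR2 : -t₂ ≤ R ^ 2 := by
    have := pow_le_pow_left₀ hr0.le hRt 2
    rwa [Real.sq_sqrt ht2.le] at this
  have h12 : -R ^ 2 ≤ t₂ := by linarith
  set β : ℝ := (α - 1) / 2 with hβdef
  have hβ0 : 0 < β := by rw [hβdef]; linarith
  have hβ1 : β < 1 := by rw [hβdef]; linarith
  have hαβ : α - 2 * β = 1 := by rw [hβdef]; ring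
  set q : ℝ := 1 + β / 2 with hqdef
  have hq1 : 1 < q := by rw [hqdef]; linarith
  have hq_sub : q - 1 = (α - 1) / 4 := by rw [hqdef, hβdef]; ring
  have h1q : 1 - q = -((α - 1) / 4) := by linarith
  set V : ℝ := volume.real (closedBall (0 : EuclideanSpace ℝ (Fin 3)) (2 * R)) with hVdef
  set V₁ : ℝ := volume.real (closedBall (0 : EuclideanSpace ℝ (Fin 3)) 1) with hV₁def
  have hV0 : 0 ≤ V := measureReal_nonneg
  have hV₁0 : 0 ≤ V₁ := measureReal_nonneg
  have hV23 : V ^ (1 / 2 : ℝ) = (2 * R) ^ (3 / 2 : ℝ) * V₁ ^ (1 / 2 : ℝ) := by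
    rw [hVdef, volumeReal_closedBall_two_mul hR.le, ← hV₁def, Real.mul_rpow (by positivity) hV₁0,
      show ((2 * R) ^ 3 : ℝ) = (2 * R) ^ (3 : ℝ) by norm_cast, ← Real.rpow_mul (by positivity)]
    norm_num
  have hC₁0 : 0 ≤ C₁ / R := (norm_nonneg _).trans (hC₁ 0)
  have hC₂0 : 0 ≤ C₂ / R ^ 2 := (abs_nonneg _).trans (hC₂ 0)
  have hC₁0' : 0 ≤ C₁ := by
    have := mul_nonneg hC₁0 hR.le; rwa [div_mul_cancel₀ _ hR.ne'] at this
  have hC₂0' : 0 ≤ C₂ := by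
    have := mul_nonneg hC₂0 (pow_pos hR 2).le; rwa [div_mul_cancel₀ _ (pow_pos hR 2).ne'] at this
  have hneg : ∀ s ∈ Icc (-R ^ 2) t₂, 0 < -s := fun s hs => by linarith [lt_of_le_of_lt hs.2 h2]
  have h2R : 0 < 2 * R := by linarith
  -- the cut-off and the integrated identity, dissipation dropped
  set φ : EuclideanSpace ℝ (Fin 3) → ℝ := cutoff (E := EuclideanSpace ℝ (Fin 3)) R with hφdef
  have hφs : ContDiff ℝ ∞ φ := contDiff_cutoff (n := ⊤) R
  have hφcs : HasCompactSupport φ := hasCompactSupport_cutoff hR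
  have hid := h.local_energy_identity_cutoff hS hφs hφcs h12 hI
  have hdiss : 0 ≤ 2 * (1 : ℝ) * ∫ s in (-R ^ 2)..t₂, ∫ x, frobeniusNormSq (fderiv ℝ (u s) x) * φ x := by
    refine mul_nonneg (by norm_num) (intervalIntegral.integral_nonneg h12 fun s _ => ?_)
    exact integral_nonneg fun x => mul_nonneg (frobeniusNormSq_nonneg _) (cutoff_nonneg R x)
  -- the level data: `e(s)`, `M(s)`, `P(s)` and the two coefficients of the majorant
  set a₁ : ℝ := C₂ / R ^ 2 * (K₀ * (2 * R) ^ α) with ha₁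
  set a₂ : ℝ := C₁ / R * V ^ (1 / 2 : ℝ) * (K₀ * (2 * R) ^ α) ^ (1 / 2 : ℝ) * (C ^ 2 + 2 * A) with ha₂
  have h2Rα : 0 ≤ K₀ * (2 * R) ^ α := mul_nonneg hK0 (Real.rpow_nonneg h2R.le _)
  have ha₁0 : 0 ≤ a₁ := mul_nonneg hC₂0 h2Rα
  have ha₂0 : 0 ≤ a₂ := by rw [ha₂]; positivity
  set g : ℝ → ℝ := fun s => a₁ * (-s) ^ (-β) + a₂ * (-s) ^ (-q) with hgdef
  -- the slice-wise flux bound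
  have hflux : ∀ s ∈ Icc (-R ^ 2) t₂, ∫ x, (1 * ((Δ φ) x * ‖u s x‖ ^ 2) + fderiv ℝ φ x (u s x) * ‖u s x‖ ^ 2 +
      2 * (p s x * fderiv ℝ φ x (u s x))) ≤ g s := by
    intro s hs
    have hs0 := hneg s hs
    have hsq : 0 < Real.sqrt (-s) := Real.sqrt_pos.2 hs0
    have hPs : 0 ≤ A / (-s) := div_nonneg hA0 hs0.le
    have hb := flux_le_two h (hI hs) hR (hC s hs) hPs (hE s hs) (hosc s hs) hC₁ hC₂
    refine hb.trans ?_
    -- rewrite the right-hand side as `g s`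
    have hM2 : (C / Real.sqrt (-s)) ^ 2 = C ^ 2 * (-s) ^ (-1 : ℝ) := by
      rw [div_pow, Real.sq_sqrt hs0.le, Real.rpow_neg_one, div_eq_mul_inv]
    have hAs : A / (-s) = A * (-s) ^ (-1 : ℝ) := by rw [Real.rpow_neg_one, div_eq_mul_inv]
    have he2 : (K₀ * (2 * R) ^ α * (-s) ^ (-β)) ^ (1 / 2 : ℝ) =
        (K₀ * (2 * R) ^ α) ^ (1 / 2 : ℝ) * (-s) ^ (-β * (1 / 2 : ℝ)) := by
      rw [Real.mul_rpow h2Rα (Real.rpow_nonneg hs0.le _), ← Real.rpow_mul hs0.le]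
    have hq' : -q = -β * (1 / 2 : ℝ) + (-1 : ℝ) := by rw [hqdef]; ring
    have hgs : C₂ / R ^ 2 * (K₀ * (2 * R) ^ α * (-s) ^ (-β)) +
        C₁ / R * V ^ (1 / 2 : ℝ) * (K₀ * (2 * R) ^ α * (-s) ^ (-β)) ^ (1 / 2 : ℝ) *
          ((C / Real.sqrt (-s)) ^ 2 + 2 * (A / (-s))) = g s := by
      show _ = a₁ * (-s) ^ (-β) + a₂ * (-s) ^ (-q)
      rw [he2, hM2, hAs, ha₁, ha₂, hq', Real.rpow_add hs0]
      ring
    exact hgs.le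
  -- integrability of the flux and of the majorant on the window
  have hGc := h.continuousOn_integral_flux_cutoff (ν := 1) hφs hφcs
  have hI' : uIcc (-R ^ 2) t₂ ⊆ Icc (-R ^ 2) t₂ := by rw [uIcc_of_le h12]
  have hGi : IntervalIntegrable (fun s => ∫ x, (1 * ((Δ φ) x * ‖u s x‖ ^ 2) +
      fderiv ℝ φ x (u s x) * ‖u s x‖ ^ 2 + 2 * (p s x * fderiv ℝ φ x (u s x)))) volume (-R ^ 2) t₂ :=
    ((hGc.mono (hI'.trans hI))).intervalIntegrable
  have hpow_cont : ∀ r : ℝ, ContinuousOn (fun s : ℝ => (-s) ^ (-r)) (uIcc (-R ^ 2) t₂) := fun r => by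
    refine ContinuousOn.rpow_const continuousOn_id.neg fun s hs => Or.inl ?_
    exact (hneg s (hI' hs)).ne'
  have hiβ : IntervalIntegrable (fun s : ℝ => (-s) ^ (-β)) volume (-R ^ 2) t₂ := (hpow_cont β).intervalIntegrable
  have hiq : IntervalIntegrable (fun s : ℝ => (-s) ^ (-q)) volume (-R ^ 2) t₂ := (hpow_cont q).intervalIntegrable
  have hgi : IntervalIntegrable g volume (-R ^ 2) t₂ := (hiβ.const_mul a₁).add (hiq.const_mul a₂)
  have hint_le : ∫ s in (-R ^ 2)..t₂, (∫ x, (1 * ((Δ φ) x * ‖u s x‖ ^ 2) +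
      fderiv ℝ φ x (u s x) * ‖u s x‖ ^ 2 + 2 * (p s x * fderiv ℝ φ x (u s x)))) ≤ ∫ s in (-R ^ 2)..t₂, g s :=
    intervalIntegral.integral_mono_on h12 hGi hgi fun s hs => hflux s hs
  -- evaluate `∫ g`
  have hg_int : ∫ s in (-R ^ 2)..t₂, g s ≤ a₁ * ((R ^ 2) ^ (1 - β) / (1 - β)) + a₂ * ((-t₂) ^ (1 - q) / (q - 1)) := by
    have e : ∫ s in (-R ^ 2)..t₂, g s =
        (a₁ * ∫ s in (-R ^ 2)..t₂, (-s) ^ (-β)) + a₂ * ∫ s in (-R ^ 2)..t₂, (-s) ^ (-q) := by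
      simp only [hgdef]
      rw [intervalIntegral.integral_add (hiβ.const_mul a₁) (hiq.const_mul a₂),
        intervalIntegral.integral_const_mul, intervalIntegral.integral_const_mul]
    rw [e]
    have h1 := intervalIntegral_neg_rpow_neg_le_of_lt_one h12 h2 hβ1
    rw [neg_neg] at h1
    have h2' := intervalIntegral_neg_rpow_neg_le_of_one_lt h12 h2 hq1
    exact add_le_add (mul_le_mul_of_nonneg_left h1 ha₁0) (mul_le_mul_of_nonneg_left h2' ha₂0)
  -- the two ends
  have hR2I : (-R ^ 2) ∈ Icc (-R ^ 2) t₂ := ⟨le_rfl, h12⟩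
  have ht2I : t₂ ∈ Icc (-R ^ 2) t₂ := ⟨h12, le_rfl⟩
  have hend₁ : ∫ x, φ x * ‖u (-R ^ 2) x‖ ^ 2 ≤ K₀ * (2 * R) ^ α * (R ^ 2) ^ (-β) := by
    have h1 := integral_cutoff_norm_sq_le_setIntegral (h.contDiff_velocity (hI hR2I)).continuous hR
    have h2' := hE (-R ^ 2) hR2I
    rw [neg_neg] at h2'
    exact h1.trans h2'
  have hend₂ : ∫ x in ball (0 : EuclideanSpace ℝ (Fin 3)) R, ‖u t₂ x‖ ^ 2 ≤ ∫ x, φ x * ‖u t₂ x‖ ^ 2 :=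
    setIntegral_ball_le_integral_cutoff (h.contDiff_velocity (hI ht2I)).continuous hR
  -- assemble the raw bound
  have hraw : ∫ x in ball (0 : EuclideanSpace ℝ (Fin 3)) R, ‖u t₂ x‖ ^ 2 ≤
      K₀ * (2 * R) ^ α * (R ^ 2) ^ (-β) + (a₁ * ((R ^ 2) ^ (1 - β) / (1 - β)) +
        a₂ * ((-t₂) ^ (1 - q) / (q - 1))) := by
    linarith [hid, hdiss, hint_le, hg_int, hend₁, hend₂]
  -- power bookkeeping: every term is `≤ (coefficient) · R^{1+α/3} (−t₂)^{−α/6}`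
  have h2Rpow : (2 * R) ^ α = 2 ^ α * R ^ α := Real.mul_rpow (by norm_num) hR.le
  have hRsq : ∀ c : ℝ, (R ^ 2) ^ c = R ^ (2 * c) := fun c => by
    rw [show (R ^ 2 : ℝ) = R ^ (2 : ℝ) by norm_cast, ← Real.rpow_mul hR.le]
  have hRR : R ^ α * R ^ (2 * -β) = R := by
    rw [← Real.rpow_add hR, show α + 2 * -β = 1 by linarith, Real.rpow_one]
  -- (i) the initial end `= K₀ 2^α R`
  have hT0 : K₀ * (2 * R) ^ α * (R ^ 2) ^ (-β) = K₀ * 2 ^ α * R := by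
    rw [h2Rpow, hRsq, mul_assoc, mul_assoc, hRR, ← mul_assoc]
  -- (ii) the Laplacian term `= C₂ K₀ 2^α R /(1−β)`
  have hT1 : a₁ * ((R ^ 2) ^ (1 - β) / (1 - β)) = K₀ * 2 ^ α * (C₂ * (2 / (3 - α))) * R := by
    have h1β : (1 - β) = (3 - α) / 2 := by rw [hβdef]; ring
    have h3α : (3 - α) ≠ 0 := by linarith
    have hR2ne : (R ^ 2 : ℝ) ≠ 0 := (pow_pos hR 2).ne'
    have hpow3 : R ^ α * (R ^ 2) ^ (1 - β) = R ^ 2 * R := by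
      rw [hRsq, ← Real.rpow_add hR, show α + 2 * (1 - β) = (2 : ℝ) + 1 by linarith, Real.rpow_add_one hR.ne']
      norm_cast
    calc a₁ * ((R ^ 2) ^ (1 - β) / (1 - β))
        = C₂ / R ^ 2 * K₀ * 2 ^ α * (R ^ α * (R ^ 2) ^ (1 - β)) / (1 - β) := by rw [ha₁, h2Rpow]; ring
      _ = C₂ / R ^ 2 * K₀ * 2 ^ α * (R ^ 2 * R) / ((3 - α) / 2) := by rw [hpow3, h1β]
      _ = K₀ * 2 ^ α * (C₂ * (2 / (3 - α))) * R := by field_simp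
  -- (iii) the flux term `= C₁ 2^{(3+α)/2} V₁^{1/2} K₀^{1/2} (C²+2A) (4/(α−1)) R^{(1+α)/2} (−t₂)^{−(α−1)/4}`
  have hT2 : a₂ * ((-t₂) ^ (1 - q) / (q - 1)) =
      C₁ * 2 ^ ((3 + α) / 2) * V₁ ^ (1 / 2 : ℝ) * K₀ ^ (1 / 2 : ℝ) * (C ^ 2 + 2 * A) * (4 / (α - 1)) *
        R ^ ((1 + α) / 2) * (-t₂) ^ (-((α - 1) / 4)) := by
    have hα1' : α - 1 ≠ 0 := by linarith
    have hsplit : (K₀ * (2 * R) ^ α) ^ (1 / 2 : ℝ) = K₀ ^ (1 / 2 : ℝ) * (2 * R) ^ (α / 2) := by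
      rw [Real.mul_rpow hK0 (Real.rpow_nonneg h2R.le _), ← Real.rpow_mul h2R.le,
        show α * (1 / 2 : ℝ) = α / 2 by ring]
    have hpow2R : (2 * R) ^ (3 / 2 : ℝ) * (2 * R) ^ (α / 2) = 2 ^ ((3 + α) / 2) * (R * R ^ ((1 + α) / 2)) := by
      rw [← Real.rpow_add h2R, show (3 / 2 : ℝ) + α / 2 = (3 + α) / 2 by ring, Real.mul_rpow (by norm_num) hR.le,
        show ((3 + α) / 2 : ℝ) = ((1 + α) / 2) + 1 by ring, Real.rpow_add_one hR.ne' ((1 + α) / 2),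
        show ((1 + α) / 2 : ℝ) + 1 = (3 + α) / 2 by ring]
      ring
    calc a₂ * ((-t₂) ^ (1 - q) / (q - 1))
        = C₁ / R * ((2 * R) ^ (3 / 2 : ℝ) * V₁ ^ (1 / 2 : ℝ)) * (K₀ ^ (1 / 2 : ℝ) * (2 * R) ^ (α / 2)) *
            (C ^ 2 + 2 * A) * ((-t₂) ^ (-((α - 1) / 4)) / ((α - 1) / 4)) := by rw [ha₂, hV23, hsplit, hq_sub, h1q]
      _ = C₁ * V₁ ^ (1 / 2 : ℝ) * K₀ ^ (1 / 2 : ℝ) * (C ^ 2 + 2 * A) * (4 / (α - 1)) *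
            (R⁻¹ * ((2 * R) ^ (3 / 2 : ℝ) * (2 * R) ^ (α / 2))) * (-t₂) ^ (-((α - 1) / 4)) := by
          field_simp
      _ = C₁ * V₁ ^ (1 / 2 : ℝ) * K₀ ^ (1 / 2 : ℝ) * (C ^ 2 + 2 * A) * (4 / (α - 1)) *
            (2 ^ ((3 + α) / 2) * R ^ ((1 + α) / 2)) * (-t₂) ^ (-((α - 1) / 4)) := by
          rw [hpow2R, show R⁻¹ * (2 ^ ((3 + α) / 2) * (R * R ^ ((1 + α) / 2))) =
            2 ^ ((3 + α) / 2) * ((R⁻¹ * R) * R ^ ((1 + α) / 2)) by ring, inv_mul_cancel₀ hR.ne', one_mul]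
      _ = _ := by ring
  -- (iv) `R ≤ R^{(1+α)/2} (−t₂)^{−(α−1)/4}` since `−t₂ ≤ R²`
  have hRle : R ≤ R ^ ((1 + α) / 2) * (-t₂) ^ (-((α - 1) / 4)) := by
    have h1 : (R ^ 2) ^ (-((α - 1) / 4)) ≤ (-t₂) ^ (-((α - 1) / 4)) :=
      Real.rpow_le_rpow_of_nonpos ht2 hR2 (by linarith)
    have h2' : R ^ ((1 + α) / 2) * (R ^ 2) ^ (-((α - 1) / 4)) = R := by
      rw [hRsq, ← Real.rpow_add hR, show (1 + α) / 2 + 2 * -((α - 1) / 4) = 1 by ring, Real.rpow_one]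
    calc R = R ^ ((1 + α) / 2) * (R ^ 2) ^ (-((α - 1) / 4)) := h2'.symm
      _ ≤ R ^ ((1 + α) / 2) * (-t₂) ^ (-((α - 1) / 4)) :=
          mul_le_mul_of_nonneg_left h1 (Real.rpow_nonneg hR.le _)
  have hX0 : 0 ≤ R ^ ((1 + α) / 2) * (-t₂) ^ (-((α - 1) / 4)) := hR.le.trans hRle
  -- final
  have hk₁ : 0 ≤ K₀ * 2 ^ α * (1 + C₂ * (2 / (3 - α))) := by
    have : 0 < 3 - α := by linarith
    positivity
  have hk₂ : 0 ≤ C₁ * 2 ^ ((3 + α) / 2) * V₁ ^ (1 / 2 : ℝ) * K₀ ^ (1 / 2 : ℝ) * (C ^ 2 + 2 * A) * (4 / (α - 1)) := by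
    have : 0 < α - 1 := by linarith
    positivity
  rw [hT0, hT1, hT2] at hraw
  calc ∫ x in ball (0 : EuclideanSpace ℝ (Fin 3)) R, ‖u t₂ x‖ ^ 2
      ≤ K₀ * 2 ^ α * R + (K₀ * 2 ^ α * (C₂ * (2 / (3 - α))) * R +
          C₁ * 2 ^ ((3 + α) / 2) * V₁ ^ (1 / 2 : ℝ) * K₀ ^ (1 / 2 : ℝ) * (C ^ 2 + 2 * A) * (4 / (α - 1)) *
            R ^ ((1 + α) / 2) * (-t₂) ^ (-((α - 1) / 4))) := hraw
    _ = (K₀ * 2 ^ α * (1 + C₂ * (2 / (3 - α)))) * R +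
          C₁ * 2 ^ ((3 + α) / 2) * V₁ ^ (1 / 2 : ℝ) * K₀ ^ (1 / 2 : ℝ) * (C ^ 2 + 2 * A) * (4 / (α - 1)) *
            (R ^ ((1 + α) / 2) * (-t₂) ^ (-((α - 1) / 4))) := by ring
    _ ≤ (K₀ * 2 ^ α * (1 + C₂ * (2 / (3 - α)))) * (R ^ ((1 + α) / 2) * (-t₂) ^ (-((α - 1) / 4))) +
          C₁ * 2 ^ ((3 + α) / 2) * V₁ ^ (1 / 2 : ℝ) * K₀ ^ (1 / 2 : ℝ) * (C ^ 2 + 2 * A) * (4 / (α - 1)) *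
            (R ^ ((1 + α) / 2) * (-t₂) ^ (-((α - 1) / 4))) := by
        gcongr
    _ = _ := by ring

end Summit.NavierStokesRegularity.NavierStokesRegularity.Theorems.PoloidalWindowDoorPoloidalWindowRigidityLargeScaleEnergyBootstrapFloorStep

end
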